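import Literature.Analysis.FluidPDE.ElgindiAngularLeibniz
import Literature.Analysis.FluidPDE.ElgindiCutoffCalculus
import HarnessLib

/-!
# `D_θ^i = Σ_m c_{i,m}(θ) ∂_θ^m` for `i ≤ 4`: the angular part of the `𝓗ᵏ` norm versus `∂_θ`-derivatives
([ElgindiGhoulMasmoudi2021] §1.7, §6; [Elgindi2021] §7.4)

Topic `Literature/Analysis/FluidPDE`. Proof file (everything proved, no definitions, no named
facts) on the proof path of the named fact
`Literature.Analysis.FluidPDE.Elgindi.ElgindiGhoulMasmoudi2021_stabilityCore`
(`ElgindiStabilityDecomposition.lean`). T. M. Elgindi, T.-E. Ghoul, N. Masmoudi, Camb. J. Math. 9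
(2021) = arXiv:1910.14071, §1.7 (p. 6 of the held text): the `𝓗ᵏ` norm is built from
"`D_θ(f) = sin(2θ)∂_θf`" and its iterates `D_θ^iD_R^jf`, whereas the elliptic estimates of §6 /
[Elgindi2021] §7.3–7.4 are proved for `∂_θ^i` with the weights `sin(2θ)^{2i−γ}`
("`|∂_θθD_R^kΨ w/sin(2θ)^{η/2}|`, `∫ sin(2θ)^{2−γ}|∂_θ∂_θθΨ|²w²`, `sin(2θ)^{4−γ}`, …,
`sin(2θ)^{2k−γ}`"). The two are equivalent order by order because
`D_θ^i = Σ_{m=1}^{i} c_{i,m}(θ)∂_θ^m` with trigonometric polynomials `c_{i,m} = O(sin(2θ)^m)`.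
This file proves the expansions for `i ≤ 4` (the orders of `𝓗⁴`) for the one-variable operator
`Dθ₁ g = sin(2θ)g′` (`ElgindiCutoffCalculus.lean`) and the resulting two-sided pointwise bounds, and
transfers them to the slices of plane functions (`iterate_Dθ_apply`):

* `iterate_Dθ₁_two/three/four`: with `S = sin 2θ`, `C = cos 2θ`,
  `Dθ₁²g = 2SC g′ + S²g″`, `Dθ₁³g = (4SC² − 4S³)g′ + 6S²C g″ + S³g‴`,
  `Dθ₁⁴g = (8SC³ − 40S³C)g′ + (28S²C² − 16S⁴)g″ + 12S³C g‴ + S⁴g⁗`;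
* `sq_iterate_Dθ₁_le_*` (up): `(Dθ₁^ig)² ≤ K_i Σ_{m=1}^{i} S^{2m}(g^{(m)})²`;
* `sq_sin_pow_mul_iteratedDeriv_le_*` (down): `S^{2i}(g^{(i)})² ≤ K_i'[(Dθ₁^ig)² + Σ_{m<i} S^{2m}(g^{(m)})²]`.
-/

noncomputable section

open MeasureTheory Set Real Filter Function
open _root_.Topology

namespace Literature.Analysis.FluidPDE

namespace Elgindi

/-! ### Slices -/

/-- `D_θ^i` acts on the angular slice: `Dθ^[i] g R θ = Dθ₁^[i] (g R ·) θ`. [folklore] -/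
theorem iterate_Dθ_apply (i : ℕ) (g : ℝ → ℝ → ℝ) (R θ : ℝ) :
    (Dθ^[i] g) R θ = (Dθ₁^[i] fun θ' => g R θ') θ := by
  induction i generalizing g θ with
  | zero => rfl
  | succ i ih =>
    rw [Function.iterate_succ_apply, Function.iterate_succ_apply, ih (Dθ g)]
    rfl

/-! ### The expansions of `Dθ₁^i`, `i ≤ 4` -/

section expansion

/-- `(sin 2θ)′ = 2cos 2θ`. [folklore] -/
private theorem hS (θ : ℝ) : HasDerivAt (fun x => Real.sin (2 * x)) (2 * Real.cos (2 * θ)) θ := by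
  have h2 : HasDerivAt (fun x : ℝ => 2 * x) 2 θ := by simpa using (hasDerivAt_id' θ).const_mul (2 : ℝ)
  simpa [mul_comm] using h2.sin

/-- `(cos 2θ)′ = −2sin 2θ`. [folklore] -/
private theorem hC (θ : ℝ) : HasDerivAt (fun x => Real.cos (2 * x)) (-(2 * Real.sin (2 * θ))) θ := by
  have h2 : HasDerivAt (fun x : ℝ => 2 * x) 2 θ := by simpa using (hasDerivAt_id' θ).const_mul (2 : ℝ)
  have := h2.cos
  simpa [mul_comm] using this

/-- `Dθ₁ g = S g′`. [folklore] -/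
theorem iterate_Dθ₁_one (g : ℝ → ℝ) : Dθ₁^[1] g = fun θ => Real.sin (2 * θ) * iteratedDeriv 1 g θ := by
  funext θ; simp [Dθ₁_apply, iteratedDeriv_one]

variable {g : ℝ → ℝ} (hg : ContDiff ℝ 4 g)
include hg

/-- `(g^{(m)})′ = g^{(m+1)}` for `m < 4`, `g ∈ C⁴`. [folklore] -/
private theorem hD (m : ℕ) (hm : m < 4) (θ : ℝ) :
    HasDerivAt (iteratedDeriv m g) (iteratedDeriv (m + 1) g θ) θ := by
  have hd : Differentiable ℝ (iteratedDeriv m g) := hg.differentiable_iteratedDeriv m (by exact_mod_cast hm)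
  rw [iteratedDeriv_succ]
  exact (hd θ).hasDerivAt

/-- **`Dθ₁²g = 2SC g′ + S²g″`** (`S = sin 2θ`, `C = cos 2θ`). [folklore] -/
theorem iterate_Dθ₁_two : Dθ₁^[2] g = fun θ => 2 * Real.sin (2 * θ) * Real.cos (2 * θ) * iteratedDeriv 1 g θ +
    Real.sin (2 * θ) ^ 2 * iteratedDeriv 2 g θ := by
  have e : Dθ₁^[2] g = Dθ₁ (Dθ₁^[1] g) := Function.iterate_succ_apply' Dθ₁ 1 g
  rw [e, iterate_Dθ₁_one g]
  funext θ
  rw [Dθ₁_apply]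
  have h := (hS θ).fun_mul (hD hg 1 (by norm_num) θ)
  rw [h.deriv]
  ring

/-- **`Dθ₁³g = (4SC² − 4S³)g′ + 6S²C g″ + S³g‴`**. [folklore] -/
theorem iterate_Dθ₁_three : Dθ₁^[3] g = fun θ =>
    (4 * Real.sin (2 * θ) * Real.cos (2 * θ) ^ 2 - 4 * Real.sin (2 * θ) ^ 3) * iteratedDeriv 1 g θ +
    6 * Real.sin (2 * θ) ^ 2 * Real.cos (2 * θ) * iteratedDeriv 2 g θ + Real.sin (2 * θ) ^ 3 * iteratedDeriv 3 g θ := by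
  have e : Dθ₁^[3] g = Dθ₁ (Dθ₁^[2] g) := Function.iterate_succ_apply' Dθ₁ 2 g
  rw [e, iterate_Dθ₁_two hg]
  funext θ
  rw [Dθ₁_apply]
  have h1 := (((hS θ).const_mul 2).fun_mul (hC θ)).fun_mul (hD hg 1 (by norm_num) θ)
  have h2 := ((hS θ).fun_pow 2).fun_mul (hD hg 2 (by norm_num) θ)
  have h := h1.fun_add h2
  rw [h.deriv]
  push_cast
  ring

/-- **`Dθ₁⁴g = (8SC³ − 40S³C)g′ + (28S²C² − 16S⁴)g″ + 12S³C g‴ + S⁴g⁗`**. [folklore] -/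
theorem iterate_Dθ₁_four : Dθ₁^[4] g = fun θ =>
    (8 * Real.sin (2 * θ) * Real.cos (2 * θ) ^ 3 - 40 * Real.sin (2 * θ) ^ 3 * Real.cos (2 * θ)) * iteratedDeriv 1 g θ +
    (28 * Real.sin (2 * θ) ^ 2 * Real.cos (2 * θ) ^ 2 - 16 * Real.sin (2 * θ) ^ 4) * iteratedDeriv 2 g θ +
    12 * Real.sin (2 * θ) ^ 3 * Real.cos (2 * θ) * iteratedDeriv 3 g θ + Real.sin (2 * θ) ^ 4 * iteratedDeriv 4 g θ := by
  have e : Dθ₁^[4] g = Dθ₁ (Dθ₁^[3] g) := Function.iterate_succ_apply' Dθ₁ 3 g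
  rw [e, iterate_Dθ₁_three hg]
  funext θ
  rw [Dθ₁_apply]
  have c1 : HasDerivAt (fun x => 4 * Real.sin (2 * x) * Real.cos (2 * x) ^ 2 - 4 * Real.sin (2 * x) ^ 3)
      (4 * (2 * Real.cos (2 * θ)) * Real.cos (2 * θ) ^ 2 + 4 * Real.sin (2 * θ) * (↑2 * Real.cos (2 * θ) ^ (2 - 1) * -(2 * Real.sin (2 * θ))) -
        4 * (↑3 * Real.sin (2 * θ) ^ (3 - 1) * (2 * Real.cos (2 * θ)))) θ :=
    ((((hS θ).const_mul 4).fun_mul ((hC θ).fun_pow 2)).sub (((hS θ).fun_pow 3).const_mul 4))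
  have h1 := c1.fun_mul (hD hg 1 (by norm_num) θ)
  have c2 : HasDerivAt (fun x => 6 * Real.sin (2 * x) ^ 2 * Real.cos (2 * x))
      (6 * (↑2 * Real.sin (2 * θ) ^ (2 - 1) * (2 * Real.cos (2 * θ))) * Real.cos (2 * θ) + 6 * Real.sin (2 * θ) ^ 2 * -(2 * Real.sin (2 * θ))) θ :=
    (((hS θ).fun_pow 2).const_mul 6).fun_mul (hC θ)
  have h2 := c2.fun_mul (hD hg 2 (by norm_num) θ)
  have h3 := ((hS θ).fun_pow 3).fun_mul (hD hg 3 (by norm_num) θ)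
  have h := (h1.fun_add h2).fun_add h3
  rw [h.deriv]
  push_cast
  ring

end expansion

/-! ### Pointwise two-sided bounds -/

/-- Trigonometric bookkeeping: `S² + C² = 1`. [folklore] -/
private theorem SC (θ : ℝ) : Real.sin (2 * θ) ^ 2 + Real.cos (2 * θ) ^ 2 = 1 := Real.sin_sq_add_cos_sq _

/-- (up, `i = 1`) `(Dθ₁ g)² = S²(g′)²`. [folklore] -/
theorem sq_iterate_Dθ₁_one (g : ℝ → ℝ) (θ : ℝ) :
    (Dθ₁^[1] g) θ ^ 2 = Real.sin (2 * θ) ^ 2 * iteratedDeriv 1 g θ ^ 2 := by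
  rw [iterate_Dθ₁_one g]; ring

/-- (up, `i = 2`) `(Dθ₁²g)² ≤ 8S²(g′)² + 2S⁴(g″)²`. [folklore] -/
theorem sq_iterate_Dθ₁_two_le {g : ℝ → ℝ} (hg : ContDiff ℝ 4 g) (θ : ℝ) :
    (Dθ₁^[2] g) θ ^ 2 ≤ 8 * (Real.sin (2 * θ) ^ 2 * iteratedDeriv 1 g θ ^ 2) + 2 * (Real.sin (2 * θ) ^ 4 * iteratedDeriv 2 g θ ^ 2) := by
  rw [iterate_Dθ₁_two hg]
  simp only []
  set S := Real.sin (2 * θ)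
  set C := Real.cos (2 * θ)
  set a := iteratedDeriv 1 g θ
  set b := iteratedDeriv 2 g θ
  have hC2 : C ^ 2 ≤ 1 := by nlinarith [SC θ]
  nlinarith [sq_nonneg (2 * S * C * a - S ^ 2 * b), mul_le_mul_of_nonneg_left hC2 (by positivity : 0 ≤ 4 * S ^ 2 * a ^ 2),
    sq_nonneg (S * a), sq_nonneg (S ^ 2 * b)]

/-- (up, `i = 3`) `(Dθ₁³g)² ≤ 48S²(g′)² + 108S⁴(g″)² + 3S⁶(g‴)²`. [folklore] -/
theorem sq_iterate_Dθ₁_three_le {g : ℝ → ℝ} (hg : ContDiff ℝ 4 g) (θ : ℝ) :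
    (Dθ₁^[3] g) θ ^ 2 ≤ 48 * (Real.sin (2 * θ) ^ 2 * iteratedDeriv 1 g θ ^ 2) + 108 * (Real.sin (2 * θ) ^ 4 * iteratedDeriv 2 g θ ^ 2) +
      3 * (Real.sin (2 * θ) ^ 6 * iteratedDeriv 3 g θ ^ 2) := by
  rw [iterate_Dθ₁_three hg]
  simp only []
  set S := Real.sin (2 * θ)
  set C := Real.cos (2 * θ)
  set a := iteratedDeriv 1 g θ
  set b := iteratedDeriv 2 g θ
  set c := iteratedDeriv 3 g θ
  have hsc := SC θ
  -- the three coefficients: |4SC² − 4S³| ≤ 4|S|… squared: (4SC²−4S³)² = 16S²(C²−S²)² ≤ 16S²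
  have k1 : (4 * S * C ^ 2 - 4 * S ^ 3) ^ 2 ≤ 16 * S ^ 2 := by
    have e : (4 * S * C ^ 2 - 4 * S ^ 3) ^ 2 = 16 * S ^ 2 * (C ^ 2 - S ^ 2) ^ 2 := by ring
    have h1 : (C ^ 2 - S ^ 2) ^ 2 ≤ 1 := by nlinarith [sq_nonneg S, sq_nonneg C]
    rw [e]; nlinarith [mul_le_mul_of_nonneg_left h1 (by positivity : 0 ≤ 16 * S ^ 2)]
  have k2 : (6 * S ^ 2 * C) ^ 2 ≤ 36 * S ^ 4 := by
    have e : (6 * S ^ 2 * C) ^ 2 = 36 * S ^ 4 * C ^ 2 := by ring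
    have h1 : C ^ 2 ≤ 1 := by nlinarith [sq_nonneg S]
    rw [e]; nlinarith [mul_le_mul_of_nonneg_left h1 (by positivity : 0 ≤ 36 * S ^ 4)]
  -- (x + y + z)² ≤ 3(x² + y² + z²)
  have h3 : ∀ x y z : ℝ, (x + y + z) ^ 2 ≤ 3 * (x ^ 2 + y ^ 2 + z ^ 2) := fun x y z => by
    nlinarith [sq_nonneg (x - y), sq_nonneg (y - z), sq_nonneg (x - z)]
  refine (h3 _ _ _).trans ?_
  have e1 : ((4 * S * C ^ 2 - 4 * S ^ 3) * a) ^ 2 = (4 * S * C ^ 2 - 4 * S ^ 3) ^ 2 * a ^ 2 := by ring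
  have e2 : (6 * S ^ 2 * C * b) ^ 2 = (6 * S ^ 2 * C) ^ 2 * b ^ 2 := by ring
  have e3 : (S ^ 3 * c) ^ 2 = S ^ 6 * c ^ 2 := by ring
  rw [e1, e2, e3]
  nlinarith [mul_le_mul_of_nonneg_right k1 (sq_nonneg a), mul_le_mul_of_nonneg_right k2 (sq_nonneg b), sq_nonneg (S ^ 3 * c)]

/-- (up, `i = 4`) `(Dθ₁⁴g)² ≤ 6400S²(g′)² + 3136S⁴(g″)² + 576S⁶(g‴)² + 4S⁸(g⁗)²`. [folklore] -/
theorem sq_iterate_Dθ₁_four_le {g : ℝ → ℝ} (hg : ContDiff ℝ 4 g) (θ : ℝ) :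
    (Dθ₁^[4] g) θ ^ 2 ≤ 6400 * (Real.sin (2 * θ) ^ 2 * iteratedDeriv 1 g θ ^ 2) + 3136 * (Real.sin (2 * θ) ^ 4 * iteratedDeriv 2 g θ ^ 2) +
      576 * (Real.sin (2 * θ) ^ 6 * iteratedDeriv 3 g θ ^ 2) + 4 * (Real.sin (2 * θ) ^ 8 * iteratedDeriv 4 g θ ^ 2) := by
  rw [iterate_Dθ₁_four hg]
  simp only []
  set S := Real.sin (2 * θ)
  set C := Real.cos (2 * θ)
  set a := iteratedDeriv 1 g θ
  set b := iteratedDeriv 2 g θ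
  set c := iteratedDeriv 3 g θ
  set d := iteratedDeriv 4 g θ
  have hsc := SC θ
  have hC2 : C ^ 2 ≤ 1 := by nlinarith [sq_nonneg S]
  have hS2 : S ^ 2 ≤ 1 := by nlinarith [sq_nonneg C]
  have k1 : (8 * S * C ^ 3 - 40 * S ^ 3 * C) ^ 2 ≤ 1600 * S ^ 2 := by
    have e : (8 * S * C ^ 3 - 40 * S ^ 3 * C) ^ 2 = 64 * S ^ 2 * (C ^ 2 * (C ^ 2 - 5 * S ^ 2) ^ 2) := by ring
    have h1 : (C ^ 2 - 5 * S ^ 2) ^ 2 ≤ 25 := by nlinarith [sq_nonneg S, sq_nonneg C]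
    have h2 : C ^ 2 * (C ^ 2 - 5 * S ^ 2) ^ 2 ≤ 25 :=
      (mul_le_mul hC2 h1 (sq_nonneg _) zero_le_one).trans (by norm_num)
    rw [e]; nlinarith [mul_le_mul_of_nonneg_left h2 (by positivity : 0 ≤ 64 * S ^ 2)]
  have k2 : (28 * S ^ 2 * C ^ 2 - 16 * S ^ 4) ^ 2 ≤ 784 * S ^ 4 := by
    have e : (28 * S ^ 2 * C ^ 2 - 16 * S ^ 4) ^ 2 = 16 * S ^ 4 * (7 * C ^ 2 - 4 * S ^ 2) ^ 2 := by ring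
    have h1 : (7 * C ^ 2 - 4 * S ^ 2) ^ 2 ≤ 49 := by nlinarith [sq_nonneg S, sq_nonneg C]
    rw [e]; nlinarith [mul_le_mul_of_nonneg_left h1 (by positivity : 0 ≤ 16 * S ^ 4)]
  have k3 : (12 * S ^ 3 * C) ^ 2 ≤ 144 * S ^ 6 := by
    have e : (12 * S ^ 3 * C) ^ 2 = 144 * S ^ 6 * C ^ 2 := by ring
    rw [e]; nlinarith [mul_le_mul_of_nonneg_left hC2 (by positivity : 0 ≤ 144 * S ^ 6)]
  have h4 : ∀ x y z t : ℝ, (x + y + z + t) ^ 2 ≤ 4 * (x ^ 2 + y ^ 2 + z ^ 2 + t ^ 2) := fun x y z t => by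
    nlinarith [sq_nonneg (x - y), sq_nonneg (y - z), sq_nonneg (x - z), sq_nonneg (x - t), sq_nonneg (y - t), sq_nonneg (z - t)]
  refine (h4 _ _ _ _).trans ?_
  have e1 : ((8 * S * C ^ 3 - 40 * S ^ 3 * C) * a) ^ 2 = (8 * S * C ^ 3 - 40 * S ^ 3 * C) ^ 2 * a ^ 2 := by ring
  have e2 : ((28 * S ^ 2 * C ^ 2 - 16 * S ^ 4) * b) ^ 2 = (28 * S ^ 2 * C ^ 2 - 16 * S ^ 4) ^ 2 * b ^ 2 := by ring
  have e3 : (12 * S ^ 3 * C * c) ^ 2 = (12 * S ^ 3 * C) ^ 2 * c ^ 2 := by ring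
  have e4 : (S ^ 4 * d) ^ 2 = S ^ 8 * d ^ 2 := by ring
  rw [e1, e2, e3, e4]
  nlinarith [mul_le_mul_of_nonneg_right k1 (sq_nonneg a), mul_le_mul_of_nonneg_right k2 (sq_nonneg b),
    mul_le_mul_of_nonneg_right k3 (sq_nonneg c), sq_nonneg (S ^ 4 * d)]

/-- (down, `i = 2`) `S⁴(g″)² ≤ 2(Dθ₁²g)² + 8S²(g′)²`. [folklore] -/
theorem sq_sin_pow_mul_iteratedDeriv_two_le {g : ℝ → ℝ} (hg : ContDiff ℝ 4 g) (θ : ℝ) :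
    Real.sin (2 * θ) ^ 4 * iteratedDeriv 2 g θ ^ 2 ≤ 2 * (Dθ₁^[2] g) θ ^ 2 + 8 * (Real.sin (2 * θ) ^ 2 * iteratedDeriv 1 g θ ^ 2) := by
  rw [iterate_Dθ₁_two hg]
  simp only []
  set S := Real.sin (2 * θ)
  set C := Real.cos (2 * θ)
  set a := iteratedDeriv 1 g θ
  set b := iteratedDeriv 2 g θ
  have hC2 : C ^ 2 ≤ 1 := by nlinarith [SC θ]
  -- S²b = D − 2SCa
  nlinarith [sq_nonneg (2 * S * C * a + S ^ 2 * b + 2 * S * C * a - S ^ 2 * b), sq_nonneg (S ^ 2 * b + 2 * (2 * S * C * a)),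
    mul_le_mul_of_nonneg_left hC2 (by positivity : 0 ≤ 4 * S ^ 2 * a ^ 2), sq_nonneg (2 * S * C * a + S ^ 2 * b - 2 * (S ^ 2 * b))]

/-- (down, `i = 3`) `S⁶(g‴)² ≤ 3(Dθ₁³g)² + 48S²(g′)² + 108S⁴(g″)²`. [folklore] -/
theorem sq_sin_pow_mul_iteratedDeriv_three_le {g : ℝ → ℝ} (hg : ContDiff ℝ 4 g) (θ : ℝ) :
    Real.sin (2 * θ) ^ 6 * iteratedDeriv 3 g θ ^ 2 ≤ 3 * (Dθ₁^[3] g) θ ^ 2 + 48 * (Real.sin (2 * θ) ^ 2 * iteratedDeriv 1 g θ ^ 2) +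
      108 * (Real.sin (2 * θ) ^ 4 * iteratedDeriv 2 g θ ^ 2) := by
  rw [iterate_Dθ₁_three hg]
  simp only []
  set S := Real.sin (2 * θ)
  set C := Real.cos (2 * θ)
  set a := iteratedDeriv 1 g θ
  set b := iteratedDeriv 2 g θ
  set c := iteratedDeriv 3 g θ
  have hsc := SC θ
  have k1 : (4 * S * C ^ 2 - 4 * S ^ 3) ^ 2 ≤ 16 * S ^ 2 := by
    have e : (4 * S * C ^ 2 - 4 * S ^ 3) ^ 2 = 16 * S ^ 2 * (C ^ 2 - S ^ 2) ^ 2 := by ring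
    have h1 : (C ^ 2 - S ^ 2) ^ 2 ≤ 1 := by nlinarith [sq_nonneg S, sq_nonneg C]
    rw [e]; nlinarith [mul_le_mul_of_nonneg_left h1 (by positivity : 0 ≤ 16 * S ^ 2)]
  have k2 : (6 * S ^ 2 * C) ^ 2 ≤ 36 * S ^ 4 := by
    have e : (6 * S ^ 2 * C) ^ 2 = 36 * S ^ 4 * C ^ 2 := by ring
    have h1 : C ^ 2 ≤ 1 := by nlinarith [sq_nonneg S]
    rw [e]; nlinarith [mul_le_mul_of_nonneg_left h1 (by positivity : 0 ≤ 36 * S ^ 4)]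
  -- z = D − x − y with x = c₁a, y = c₂b: z² ≤ 3(D² + x² + y²)
  have h3 : ∀ D x y : ℝ, (D - x - y) ^ 2 ≤ 3 * (D ^ 2 + x ^ 2 + y ^ 2) := fun D x y => by
    nlinarith [sq_nonneg (D + x), sq_nonneg (D + y), sq_nonneg (x - y)]
  have e : S ^ 6 * c ^ 2 = ((4 * S * C ^ 2 - 4 * S ^ 3) * a + 6 * S ^ 2 * C * b + S ^ 3 * c - (4 * S * C ^ 2 - 4 * S ^ 3) * a - 6 * S ^ 2 * C * b) ^ 2 := by ring
  rw [e]
  refine (h3 _ _ _).trans ?_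
  have e1 : ((4 * S * C ^ 2 - 4 * S ^ 3) * a) ^ 2 = (4 * S * C ^ 2 - 4 * S ^ 3) ^ 2 * a ^ 2 := by ring
  have e2 : (6 * S ^ 2 * C * b) ^ 2 = (6 * S ^ 2 * C) ^ 2 * b ^ 2 := by ring
  rw [e1, e2]
  nlinarith [mul_le_mul_of_nonneg_right k1 (sq_nonneg a), mul_le_mul_of_nonneg_right k2 (sq_nonneg b)]

/-- (down, `i = 4`) `S⁸(g⁗)² ≤ 4(Dθ₁⁴g)² + 6400S²(g′)² + 3136S⁴(g″)² + 576S⁶(g‴)²`. [folklore] -/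
theorem sq_sin_pow_mul_iteratedDeriv_four_le {g : ℝ → ℝ} (hg : ContDiff ℝ 4 g) (θ : ℝ) :
    Real.sin (2 * θ) ^ 8 * iteratedDeriv 4 g θ ^ 2 ≤ 4 * (Dθ₁^[4] g) θ ^ 2 + 6400 * (Real.sin (2 * θ) ^ 2 * iteratedDeriv 1 g θ ^ 2) +
      3136 * (Real.sin (2 * θ) ^ 4 * iteratedDeriv 2 g θ ^ 2) + 576 * (Real.sin (2 * θ) ^ 6 * iteratedDeriv 3 g θ ^ 2) := by
  rw [iterate_Dθ₁_four hg]
  simp only []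
  set S := Real.sin (2 * θ)
  set C := Real.cos (2 * θ)
  set a := iteratedDeriv 1 g θ
  set b := iteratedDeriv 2 g θ
  set c := iteratedDeriv 3 g θ
  set d := iteratedDeriv 4 g θ
  have hsc := SC θ
  have hC2 : C ^ 2 ≤ 1 := by nlinarith [sq_nonneg S]
  have k1 : (8 * S * C ^ 3 - 40 * S ^ 3 * C) ^ 2 ≤ 1600 * S ^ 2 := by
    have e : (8 * S * C ^ 3 - 40 * S ^ 3 * C) ^ 2 = 64 * S ^ 2 * (C ^ 2 * (C ^ 2 - 5 * S ^ 2) ^ 2) := by ring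
    have h1 : (C ^ 2 - 5 * S ^ 2) ^ 2 ≤ 25 := by nlinarith [sq_nonneg S, sq_nonneg C]
    have h2 : C ^ 2 * (C ^ 2 - 5 * S ^ 2) ^ 2 ≤ 25 :=
      (mul_le_mul hC2 h1 (sq_nonneg _) zero_le_one).trans (by norm_num)
    rw [e]; nlinarith [mul_le_mul_of_nonneg_left h2 (by positivity : 0 ≤ 64 * S ^ 2)]
  have k2 : (28 * S ^ 2 * C ^ 2 - 16 * S ^ 4) ^ 2 ≤ 784 * S ^ 4 := by
    have e : (28 * S ^ 2 * C ^ 2 - 16 * S ^ 4) ^ 2 = 16 * S ^ 4 * (7 * C ^ 2 - 4 * S ^ 2) ^ 2 := by ring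
    have h1 : (7 * C ^ 2 - 4 * S ^ 2) ^ 2 ≤ 49 := by nlinarith [sq_nonneg S, sq_nonneg C]
    rw [e]; nlinarith [mul_le_mul_of_nonneg_left h1 (by positivity : 0 ≤ 16 * S ^ 4)]
  have k3 : (12 * S ^ 3 * C) ^ 2 ≤ 144 * S ^ 6 := by
    have e : (12 * S ^ 3 * C) ^ 2 = 144 * S ^ 6 * C ^ 2 := by ring
    rw [e]; nlinarith [mul_le_mul_of_nonneg_left hC2 (by positivity : 0 ≤ 144 * S ^ 6)]
  have h4 : ∀ D x y z : ℝ, (D - x - y - z) ^ 2 ≤ 4 * (D ^ 2 + x ^ 2 + y ^ 2 + z ^ 2) := fun D x y z => by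
    nlinarith [sq_nonneg (D + x), sq_nonneg (D + y), sq_nonneg (D + z), sq_nonneg (x - y), sq_nonneg (x - z), sq_nonneg (y - z)]
  have e : S ^ 8 * d ^ 2 = ((8 * S * C ^ 3 - 40 * S ^ 3 * C) * a + (28 * S ^ 2 * C ^ 2 - 16 * S ^ 4) * b + 12 * S ^ 3 * C * c + S ^ 4 * d -
      (8 * S * C ^ 3 - 40 * S ^ 3 * C) * a - (28 * S ^ 2 * C ^ 2 - 16 * S ^ 4) * b - 12 * S ^ 3 * C * c) ^ 2 := by ring
  rw [e]
  refine (h4 _ _ _ _).trans ?_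
  have e1 : ((8 * S * C ^ 3 - 40 * S ^ 3 * C) * a) ^ 2 = (8 * S * C ^ 3 - 40 * S ^ 3 * C) ^ 2 * a ^ 2 := by ring
  have e2 : ((28 * S ^ 2 * C ^ 2 - 16 * S ^ 4) * b) ^ 2 = (28 * S ^ 2 * C ^ 2 - 16 * S ^ 4) ^ 2 * b ^ 2 := by ring
  have e3 : (12 * S ^ 3 * C * c) ^ 2 = (12 * S ^ 3 * C) ^ 2 * c ^ 2 := by ring
  rw [e1, e2, e3]
  nlinarith [mul_le_mul_of_nonneg_right k1 (sq_nonneg a), mul_le_mul_of_nonneg_right k2 (sq_nonneg b),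
    mul_le_mul_of_nonneg_right k3 (sq_nonneg c)]

end Elgindi

end Literature.Analysis.FluidPDE
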